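import Summits.KontsevichZagierPeriods.KontsevichZagierPeriods.Theorems.RootDecompWalshStrataEulerDescent03

/-!
# Conic descent, gen 6 (L4 one-variable Euler descent `[T, R(x)·√(ex²+fx+g)^{±1}] ∈ InBaker`), part 4/12

Declarations `InBaker.even_hyperbola_right` … `identity` of the farm-checked gen-6 monolith; see the module docstring of
`EulerDescent01` (part 1) for the overview, the design and the sources. [KontsevichZagier2001 §1.1–1.2; BCR1998 §2.2; Euler 1768; this node gen 4 `sqrtDescent_*`]
-/

noncomputable section

open Literature.NumberTheory.Transcendental
open MeasureTheory Set
open MvPolynomial (aeval)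
open Literature.ModelTheory.ExponentialFields (IsSemialgebraic isSemialgebraic_univ
  isSemialgebraic_setOf_eval_pos isSemialgebraic_setOf_eval_lt isSemialgebraic_setOf_eval_le
  isSemialgebraic_setOf_eval_nonneg isSemialgebraic_setOf_eval_eq_zero continuous_aeval_real
  tarski_seidenberg_real_holds)

namespace Summit.KontsevichZagierPeriods.RootDecompWalshStrata.ConicDescent

/-- The derivative of `s ↦ s²` at `t` is `2t` (part-local `private` copy). [folklore] -/
private theorem hasDerivAt_sq' (t : ℝ) : HasDerivAt (fun s : ℝ => s ^ 2) (2 * t) t := by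
  simpa using hasDerivAt_pow 2 t

/-- **Even factor, right branch of the outer hyperbola** (`e > 0`, `h < 0`, domain inside
`{x > x₀, D > 0}`): with `k = −h`, `w₀ = √(k/e)` and the gen-4 chart `x = x₀ + w₀(t² + e)/(t² − e)`,
`t > √e`: `(x − x₀)² = (k/e)·V(t)² ∈ ℚ(t)` and `√D·|dx/dt| = 8ek·t²/(t² − e)³`. [this node] -/
theorem InBaker.even_hyperbola_right (e f g : ℚ) (he : 0 < e) (hh : g - f ^ 2 / (4 * e) < 0)
    (P Q : Polynomial ℚ) (r : KZ.IntegralRep 1)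
    (hdom : ∀ v ∈ r.domain, (((-f / (2 * e) : ℚ) : ℝ)) < v 0 ∧ 0 < qD e f g (v 0))
    (hQ : ∀ v ∈ r.domain, Polynomial.aeval ((v 0 - ((-f / (2 * e) : ℚ) : ℝ)) ^ 2) Q ≠ 0)
    (hr : EqOn r.integrand (fun v =>
      Polynomial.aeval ((v 0 - ((-f / (2 * e) : ℚ) : ℝ)) ^ 2) P /
        Polynomial.aeval ((v 0 - ((-f / (2 * e) : ℚ) : ℝ)) ^ 2) Q * √(qD e f g (v 0))) r.domain) :
    InBaker (KZ.of r) := by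
  have he0 : (0 : ℝ) < e := by exact_mod_cast he
  have hk : (0 : ℚ) < f ^ 2 / (4 * e) - g := by linarith
  have hk0 : (0 : ℝ) < ((f ^ 2 / (4 * e) - g : ℚ) : ℝ) := by exact_mod_cast hk
  set K : ℝ := ((f ^ 2 / (4 * e) - g : ℚ) : ℝ) with hKdef
  set X₀ : ℝ := ((-f / (2 * e) : ℚ) : ℝ) with hX₀def
  have hKe : K = f ^ 2 / (4 * e) - g := by rw [hKdef]; push_cast; ring
  have hX₀e : X₀ = -f / (2 * e) := by rw [hX₀def]; push_cast; ring
  have hHK : ((g - f ^ 2 / (4 * e) : ℚ) : ℝ) = -K := by rw [hKe]; push_cast; ring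
  set w₀ : ℝ := √(K / e) with hw₀def
  have hw₀ : 0 < w₀ := Real.sqrt_pos.2 (div_pos hk0 he0)
  have hw₀sq : w₀ ^ 2 = K / e := Real.sq_sqrt (div_pos hk0 he0).le
  have hKw : K = e * w₀ ^ 2 := by rw [hw₀sq]; field_simp
  have hG : (g : ℝ) = f ^ 2 / (4 * e) - e * w₀ ^ 2 := by rw [← hKw, hKe]; ring
  have hE : ∀ v : Fin 1 → ℝ, v ∈ {v : Fin 1 → ℝ | (e : ℝ) < v 0 ^ 2 ∧ 0 < v 0} →
      0 < v 0 ^ 2 - (e : ℝ) := fun v hv => sub_pos.2 hv.1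
  set V : ℝ → ℝ := fun s => (s ^ 2 + e) / (s ^ 2 - e) with hVdef
  set gφ : ℝ → ℝ := fun s => X₀ + w₀ * V s with hgdef
  set g' : ℝ → ℝ := fun s => w₀ * (-4 * e * s) / (s ^ 2 - e) ^ 2 with hg'def
  have hV : IsRatOn {v : Fin 1 → ℝ | (e : ℝ) < v 0 ^ 2 ∧ 0 < v 0} fun v => V (v 0) :=
    (((IsRatOn.coord.pow 2).add (IsRatOn.const e)).div ((IsRatOn.coord.pow 2).sub
      (IsRatOn.const e)) fun v hv => (hE v hv).ne').congr fun v _ => by simp only [hVdef]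
  -- `U = (gφ − x₀)² = (k/e)·V²`
  obtain ⟨U, hUdef⟩ : ∃ U : (Fin 1 → ℝ) → ℝ, U = fun v => K / e * V (v 0) ^ 2 := ⟨_, rfl⟩
  have hUv : ∀ v, U v = K / e * V (v 0) ^ 2 := fun v => by rw [hUdef]
  have hUg : ∀ v : Fin 1 → ℝ, (gφ (v 0) - X₀) ^ 2 = U v := fun v => by
    rw [hUv]; simp only [hgdef]; rw [← hw₀sq]; ring
  have hU : IsRatOn {v : Fin 1 → ℝ | (e : ℝ) < v 0 ^ 2 ∧ 0 < v 0} U :=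
    ((IsRatOn.const ((f ^ 2 / (4 * e) - g) / e)).mul (hV.pow 2)).congr fun v _ => by
      rw [hUv, hKdef]; push_cast; ring
  obtain ⟨T₀, hT₀def⟩ : ∃ T₀ : Set (Fin 1 → ℝ),
      T₀ = {v | v ∈ {v : Fin 1 → ℝ | (e : ℝ) < v 0 ^ 2 ∧ 0 < v 0} ∧
        Polynomial.aeval (U v) Q ≠ 0} := ⟨_, rfl⟩
  have hT₀ : IsSemialgebraic ℚ T₀ := by
    rw [hT₀def]; exact (hU.polyAeval Q).isSemialgebraic_sep_ne_zero (isSemialgebraic_T_sq_gt e)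
  have hT₀sub : T₀ ⊆ {v : Fin 1 → ℝ | (e : ℝ) < v 0 ^ 2 ∧ 0 < v 0} := fun v hv => by
    rw [hT₀def] at hv; exact hv.1
  have hT₀Q : ∀ v ∈ T₀, Polynomial.aeval (U v) Q ≠ 0 := fun v hv => by
    rw [hT₀def] at hv; exact hv.2
  have hU₀ : IsRatOn T₀ U := hU.mono hT₀sub
  refine InBaker.of_cov₁_rat r hT₀ gφ g' ?_ ?_ ?_ ?_
    (fun v => Polynomial.aeval (U v) P / Polynomial.aeval (U v) Q *
      (8 * (e : ℝ) * K * v 0 ^ 2 / (v 0 ^ 2 - (e : ℝ)) ^ 3)) ?_ fun v hv hvd => ?_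
  · -- semialgebraic (gen 4), restricted
    have hc : IsSemialgebraicFunOn ℚ {v : Fin 1 → ℝ | (e : ℝ) < v 0 ^ 2 ∧ 0 < v 0} fun _ => w₀ :=
      (IsSemialgebraicFunOn.sqrt_holds (isSemialgebraicFunOn_ratCast (isSemialgebraic_T_sq_gt e)
        ((f ^ 2 / (4 * e) - g) / e))).congr fun v _ => by
          rw [hw₀def, hKdef]; push_cast; ring_nf
    exact (((isSemialgebraicFunOn_ratCast (isSemialgebraic_T_sq_gt e) (-f / (2 * e))).add_holds
      (hc.mul_holds (hV.isSemialgebraicFunOn (isSemialgebraic_T_sq_gt e)))).congr fun v _ => by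
        simp only [hgdef, hX₀def, Pi.add_apply, Pi.mul_apply]).mono hT₀sub hT₀
  · -- derivative
    intro v hv
    have hv' := hT₀sub hv
    have h1 : HasDerivAt (fun s : ℝ => s ^ 2 + (e : ℝ)) (2 * v 0) (v 0) :=
      (hasDerivAt_sq' (v 0)).add_const (e : ℝ)
    have h2 : HasDerivAt (fun s : ℝ => s ^ 2 - (e : ℝ)) (2 * v 0) (v 0) :=
      (hasDerivAt_sq' (v 0)).sub_const (e : ℝ)
    have h3 := ((h1.div h2 (hE v hv').ne').const_mul w₀).const_add X₀
    refine h3.congr_deriv ?_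
    have hd := (hE v hv').ne'
    simp only [hg'def]
    field_simp
    ring
  · -- injective
    intro s hs t ht hst
    have hs' := hT₀sub hs
    have ht' := hT₀sub ht
    have hs0 : 0 < s 0 := hs'.2
    have ht0 : 0 < t 0 := ht'.2
    have h1 : V (s 0) = V (t 0) := by
      have h' : X₀ + w₀ * V (s 0) = X₀ + w₀ * V (t 0) := hst
      exact mul_left_cancel₀ hw₀.ne' (add_left_cancel h')
    have h1' : (s 0 ^ 2 + e) / (s 0 ^ 2 - e) = (t 0 ^ 2 + e) / (t 0 ^ 2 - e) := h1
    rw [div_eq_div_iff (hE s hs').ne' (hE t ht').ne'] at h1'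
    have h2 : s 0 ^ 2 = t 0 ^ 2 := by
      have h3 : (e : ℝ) * s 0 ^ 2 = e * t 0 ^ 2 := by linarith
      exact mul_left_cancel₀ he0.ne' h3
    exact (pow_left_inj₀ hs0.le ht0.le two_ne_zero).1 h2
  · -- surjective onto the domain (`u > w₀`)
    intro x hx
    obtain ⟨hxX, hxD⟩ := hdom x hx
    obtain ⟨u, hudef⟩ : ∃ u : ℝ, u = x 0 - X₀ := ⟨_, rfl⟩
    have hu : 0 < u := by rw [hudef]; exact sub_pos.2 hxX
    have hD' : 0 < (e : ℝ) * u ^ 2 - K := by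
      rw [qD_eq_vertex e f g he.ne', hHK, ← hX₀def, ← hudef] at hxD
      linarith
    have hu2 : w₀ ^ 2 < u ^ 2 := by
      rw [hw₀sq, div_lt_iff₀ he0]
      linarith
    obtain ⟨_, hwu⟩ := abs_lt_of_sq_lt_sq' hu2 hu.le
    have hum : 0 < u - w₀ := sub_pos.2 hwu
    have hup : 0 < u + w₀ := by linarith
    obtain ⟨t, htdef⟩ : ∃ t : ℝ, t = √(e * (u + w₀) / (u - w₀)) := ⟨_, rfl⟩
    have ht : 0 < t := by rw [htdef]; exact Real.sqrt_pos.2 (div_pos (mul_pos he0 hup) hum)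
    have ht2 : t ^ 2 = e * (u + w₀) / (u - w₀) := by
      rw [htdef]; exact Real.sq_sqrt (div_pos (mul_pos he0 hup) hum).le
    have hum0 : u - w₀ ≠ 0 := hum.ne'
    have hm : t ^ 2 - e = 2 * e * w₀ / (u - w₀) := by rw [ht2]; field_simp; ring
    have hp : t ^ 2 + e = 2 * e * u / (u - w₀) := by rw [ht2]; field_simp; ring
    have hte : (e : ℝ) < t ^ 2 := by
      have : 0 < t ^ 2 - e := by rw [hm]; positivity
      linarith
    have hgt : gφ t = x 0 := by
      change X₀ + w₀ * ((t ^ 2 + e) / (t ^ 2 - e)) = x 0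
      have hew : (2 : ℝ) * e * w₀ ≠ 0 := by positivity
      rw [hm, hp]
      field_simp
      rw [hudef]
      ring
    refine ⟨fun _ => t, ?_, hgt⟩
    rw [hT₀def]
    refine ⟨⟨hte, ht⟩, ?_⟩
    have hUt : U (fun _ => t) = (x 0 - X₀) ^ 2 := by rw [← hUg (fun _ => t)]; simp only [hgt]
    change Polynomial.aeval (U fun _ => t) Q ≠ 0
    rw [hUt]
    exact hQ x hx
  · -- rational integrand
    have hrat : IsRatOn T₀ fun v => 8 * (e : ℝ) * K * v 0 ^ 2 / (v 0 ^ 2 - (e : ℝ)) ^ 3 :=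
      (((IsRatOn.const (8 * e * (f ^ 2 / (4 * e) - g))).mul (IsRatOn.coord.pow 2)).div
        (((IsRatOn.coord.pow 2).sub (IsRatOn.const e)).pow 3) fun v hv =>
          pow_ne_zero 3 (hE v (hT₀sub hv)).ne').congr fun v _ => by
        rw [hKdef]; push_cast; ring
    exact ((hU₀.polyAeval P).div (hU₀.polyAeval Q) hT₀Q).mul hrat
  · -- pulled-back integrand
    have hv' := hT₀sub hv
    have hEv := hE v hv'
    have hQv := hT₀Q v hv
    have hv0 : 0 < v 0 := hv'.2
    have hd : v 0 ^ 2 - (e : ℝ) ≠ 0 := hEv.ne'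
    have hnum : 0 < 2 * w₀ * (e : ℝ) * v 0 / (v 0 ^ 2 - e) := by positivity
    have hWv : (e : ℝ) * (gφ (v 0)) ^ 2 + f * gφ (v 0) + g =
        (2 * w₀ * (e : ℝ) * v 0 / (v 0 ^ 2 - e)) ^ 2 := by
      simp only [hgdef, hVdef]
      rw [hG, hX₀e]
      field_simp
      ring
    have hsq : √((e : ℝ) * (gφ (v 0)) ^ 2 + f * gφ (v 0) + g) =
        2 * w₀ * (e : ℝ) * v 0 / (v 0 ^ 2 - e) := by
      rw [hWv, Real.sqrt_sq hnum.le]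
    have habs : |g' (v 0)| = w₀ * (4 * e * v 0) / (v 0 ^ 2 - e) ^ 2 := by
      simp only [hg'def]
      rw [show w₀ * (-4 * (e : ℝ) * v 0) / (v 0 ^ 2 - e) ^ 2 =
          -(w₀ * (4 * e * v 0) / (v 0 ^ 2 - e) ^ 2) by ring, abs_neg, abs_of_pos]
      positivity
    rw [hr hvd]
    have hlift : lift₁ gφ v 0 = gφ (v 0) := rfl
    simp only [qD, hlift]
    rw [hUg v, hsq, habs, hKw]
    field_simp
    ring

/-- **Even factor, outer hyperbola** (`e > 0`, `h < 0`, any domain): restrict to `{D > 0}`, split at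
the vertex, reflect the left branch onto the right one (the integrand is reflection-invariant) and
apply `InBaker.even_hyperbola_right` twice. [this node] -/
theorem InBaker.even_hyperbola_out (e f g : ℚ) (he : 0 < e) (hh : g - f ^ 2 / (4 * e) < 0)
    (P Q : Polynomial ℚ) (r : KZ.IntegralRep 1)
    (hQ : ∀ v ∈ r.domain, Polynomial.aeval ((v 0 - ((-f / (2 * e) : ℚ) : ℝ)) ^ 2) Q ≠ 0)
    (hr : EqOn r.integrand (fun v =>
      Polynomial.aeval ((v 0 - ((-f / (2 * e) : ℚ) : ℝ)) ^ 2) P /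
        Polynomial.aeval ((v 0 - ((-f / (2 * e) : ℚ) : ℝ)) ^ 2) Q * √(qD e f g (v 0))) r.domain) :
    InBaker (KZ.of r) := by
  set X₀ : ℝ := ((-f / (2 * e) : ℚ) : ℝ) with hX₀def
  have hc : (((2 * (-f / (2 * e)) : ℚ) : ℝ)) = 2 * X₀ := by rw [hX₀def]; push_cast; ring
  refine InBaker.restrict_pos e f g r _ hr fun r₁ hsub hpos hr₁ => ?_
  refine InBaker.of_split_at (-f / (2 * e)) r₁ (fun r₂ hd₂ hi₂ => ?_) fun r₂ hd₂ hi₂ => ?_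
  · refine InBaker.even_hyperbola_right e f g he hh P Q r₂ (fun v hv => ?_) (fun v hv => ?_)
      fun v hv => ?_
    · rw [hd₂] at hv; exact ⟨hv.2, hpos v hv.1⟩
    · rw [hd₂] at hv; exact hQ v (hsub hv.1)
    · rw [hd₂] at hv; rw [hi₂]; exact hr₁ hv.1
  · refine InBaker.of_reflect' (2 * (-f / (2 * e))) r₂ (isSemialgebraic_rightQ e f g Q)
      (fun x hx => ?_)
      (fun v => Polynomial.aeval ((v 0 - X₀) ^ 2) P / Polynomial.aeval ((v 0 - X₀) ^ 2) Q *
        √(qD e f g (v 0))) ?_ (fun v hv hvd => ?_) fun r₃ hd₃ hi₃ => ?_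
    · rw [hd₂] at hx
      obtain ⟨hx₁, hxlt⟩ := hx
      have hD := hpos x hx₁
      refine ⟨⟨?_, ?_⟩, ?_⟩
      · change X₀ < (((2 * (-f / (2 * e)) : ℚ) : ℝ)) - x 0
        rw [hc]; linarith
      · change 0 < qD e f g ((((2 * (-f / (2 * e)) : ℚ) : ℝ)) - x 0)
        rw [hc, hX₀def, qD_reflect e f g he.ne']; exact hD
      · change Polynomial.aeval (((((2 * (-f / (2 * e)) : ℚ) : ℝ)) - x 0 - X₀) ^ 2) Q ≠ 0
        rw [hc, show (2 * X₀ - x 0 - X₀) ^ 2 = (x 0 - X₀) ^ 2 by ring]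
        exact hQ x (hsub hx₁)
    · have hS := isSemialgebraic_rightQ e f g Q
      have hu : IsRatOn {v : Fin 1 → ℝ | v ∈ {v : Fin 1 → ℝ | (((-f / (2 * e) : ℚ) : ℝ)) < v 0 ∧
          0 < qD e f g (v 0)} ∧ Polynomial.aeval ((v 0 - ((-f / (2 * e) : ℚ) : ℝ)) ^ 2) Q ≠ 0}
          fun v => v 0 - X₀ := IsRatOn.coord.sub (IsRatOn.const _)
      have h1 := ((hu.pow 2).polyAeval P).div ((hu.pow 2).polyAeval Q) fun v hv => hv.2
      exact ((h1.isSemialgebraicFunOn hS).mul_holds (IsSemialgebraicFunOn.sqrt_holds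
        (isSemialgebraicFunOn_qD e f g hS))).congr fun v _ => by simp only [Pi.mul_apply]
    · have hvd' : (fun _ : Fin 1 => (((2 * (-f / (2 * e)) : ℚ) : ℝ)) - v 0) ∈ r₁.domain := by
        rw [hd₂] at hvd; exact hvd.1
      rw [hi₂, hr₁ hvd']
      simp only [hc]
      rw [hX₀def, qD_reflect e f g he.ne', ← hX₀def,
        show (2 * X₀ - v 0 - X₀) ^ 2 = (v 0 - X₀) ^ 2 by ring]
    · refine InBaker.even_hyperbola_right e f g he hh P Q r₃ (fun v hv => ?_) (fun v hv => ?_)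
        fun v hv => ?_
      · rw [hd₃] at hv; exact hv.1.1
      · rw [hd₃] at hv; exact hv.1.2
      · rw [hi₃]

/-- **Even factor, `e < 0`, `h ≤ 0`**: then `D ≤ 0` everywhere and the integrand vanishes. -/
theorem InBaker.even_nonpos (e f g : ℚ) (he : e < 0) (hh : g - f ^ 2 / (4 * e) ≤ 0)
    (F : (Fin 1 → ℝ) → ℝ) (r : KZ.IntegralRep 1)
    (hr : EqOn r.integrand (fun v => F v * √(qD e f g (v 0))) r.domain) :
    InBaker (KZ.of r) := by
  refine InBaker.restrict_pos e f g r F hr fun r₁ _ hpos _ => ?_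
  rcases r₁.domain.eq_empty_or_nonempty with hemp | ⟨v₀, hv₀⟩
  · exact InBaker.of_mem_relations
      (KZ.of_mem_relations_of_volume_eq_zero r₁ (by rw [hemp, measure_empty]))
  · have hD := hpos v₀ hv₀
    rw [qD_eq_vertex e f g he.ne] at hD
    have hh' : ((g - f ^ 2 / (4 * e) : ℚ) : ℝ) ≤ 0 := by exact_mod_cast hh
    have he' : (e : ℝ) < 0 := by exact_mod_cast he
    exact absurd hD (not_lt.2 (by nlinarith [sq_nonneg (v₀ 0 - ((-f / (2 * e) : ℚ) : ℝ))]))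

/-- **EVEN-FACTOR DESCENT** for every genuinely quadratic radicand off the degenerate stratum
`h = 0` (`e ≠ 0`, `h = g − f²/(4e) ≠ 0`): `[T, S((x − x₀)²)·√(e x² + f x + g)] ∈ InBaker` for any
`S = P/Q ∈ ℚ(s)` with `Q((x − x₀)²) ≠ 0` on `T`. [this node] -/
theorem InBaker.even_factor (e f g : ℚ) (he : e ≠ 0) (hh : g - f ^ 2 / (4 * e) ≠ 0)
    (P Q : Polynomial ℚ) (r : KZ.IntegralRep 1)
    (hQ : ∀ v ∈ r.domain, Polynomial.aeval ((v 0 - ((-f / (2 * e) : ℚ) : ℝ)) ^ 2) Q ≠ 0)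
    (hr : EqOn r.integrand (fun v =>
      Polynomial.aeval ((v 0 - ((-f / (2 * e) : ℚ) : ℝ)) ^ 2) P /
        Polynomial.aeval ((v 0 - ((-f / (2 * e) : ℚ) : ℝ)) ^ 2) Q * √(qD e f g (v 0))) r.domain) :
    InBaker (KZ.of r) := by
  rcases lt_or_gt_of_ne he with he' | he'
  · rcases lt_or_gt_of_ne hh with hh' | hh'
    · exact InBaker.even_nonpos e f g he' hh'.le _ r hr
    · exact InBaker.even_ellipse e f g he' hh' P Q r hQ hr
  · rcases lt_or_gt_of_ne hh with hh' | hh'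
    · exact InBaker.even_hyperbola_out e f g he' hh' P Q r hQ hr
    · exact InBaker.even_hyperbola_in e f g he' hh' P Q r hQ hr


/-! #### 24.5 Euler's parity decomposition `R(x₀ + u) = E(u²) + u·O(u²)`; the general factor -/

/-- `v ↦ D(v₀) = e v₀² + f v₀ + g` is a rational function over `ℚ`. -/
theorem IsRatOn.quad (e f g : ℚ) {T : Set (Fin 1 → ℝ)} : IsRatOn T fun v => qD e f g (v 0) :=
  ((((IsRatOn.const e).mul (IsRatOn.coord.pow 2)).add ((IsRatOn.const f).mul IsRatOn.coord)).add
    (IsRatOn.const g)).congr fun v _ => by simp only [qD]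

namespace Parity

/-- Even-indexed coefficients: `(ev F)(s) = Σᵢ F₂ᵢ sⁱ`. -/
def ev (F : Polynomial ℚ) : Polynomial ℚ := Polynomial.contract 2 F

/-- Odd-indexed coefficients: `(od F)(s) = Σᵢ F₂ᵢ₊₁ sⁱ`. -/
def od (F : Polynomial ℚ) : Polynomial ℚ := Polynomial.contract 2 (Polynomial.divX F)

/-- Coefficients of the even contraction. -/
theorem coeff_ev (F : Polynomial ℚ) (i : ℕ) : (ev F).coeff i = F.coeff (2 * i) := by
  rw [ev, Polynomial.coeff_contract two_ne_zero, mul_comm]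

/-- Coefficients of the odd contraction. -/
theorem coeff_od (F : Polynomial ℚ) (i : ℕ) : (od F).coeff i = F.coeff (2 * i + 1) := by
  rw [od, Polynomial.coeff_contract two_ne_zero, Polynomial.coeff_divX, mul_comm]

/-- `F(X) = (ev F)(X²) + X·(od F)(X²)`. [folklore] -/
theorem expand_ev_add (F : Polynomial ℚ) :
    Polynomial.expand ℚ 2 (ev F) + Polynomial.X * Polynomial.expand ℚ 2 (od F) = F := by
  ext n
  rw [Polynomial.coeff_add]
  obtain ⟨i, rfl | rfl⟩ := Nat.even_or_odd' n
  · rw [Polynomial.coeff_expand two_pos, if_pos (dvd_mul_right 2 i),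
      Nat.mul_div_cancel_left i two_pos, coeff_ev]
    rcases i with _ | j
    · simp
    · rw [show 2 * (j + 1) = 2 * j + 1 + 1 by ring, Polynomial.coeff_X_mul,
        Polynomial.coeff_expand two_pos, if_neg (by omega), add_zero]
  · rw [Polynomial.coeff_X_mul, Polynomial.coeff_expand two_pos, if_neg (by omega),
      Polynomial.coeff_expand two_pos, if_pos (dvd_mul_right 2 i),
      Nat.mul_div_cancel_left i two_pos, coeff_od, zero_add]

/-- Evaluation: `F(u) = (ev F)(u²) + u·(od F)(u²)`. [folklore] -/
theorem aeval_eq (F : Polynomial ℚ) (u : ℝ) :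
    Polynomial.aeval u F =
      Polynomial.aeval (u ^ 2) (ev F) + u * Polynomial.aeval (u ^ 2) (od F) := by
  conv_lhs => rw [← expand_ev_add F]
  rw [map_add, map_mul, Polynomial.aeval_X, Polynomial.expand_aeval, Polynomial.expand_aeval]

/-- Shift to a base point: `(sh x₀ F)(u) = F(x₀ + u)`. -/
def sh (x₀ : ℚ) (F : Polynomial ℚ) : Polynomial ℚ := F.comp (Polynomial.X + Polynomial.C x₀)

/-- Evaluation of the shifted polynomial. -/
theorem aeval_sh (x₀ : ℚ) (F : Polynomial ℚ) (u : ℝ) :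
    Polynomial.aeval u (sh x₀ F) = Polynomial.aeval ((x₀ : ℝ) + u) F := by
  rw [sh, Polynomial.aeval_comp]
  simp only [map_add, Polynomial.aeval_X, Polynomial.aeval_C, eq_ratCast]
  rw [add_comm]

/-- The even denominator: `den₂(u²) = Q(x₀ + u)·Q(x₀ − u)`. -/
def den₂ (x₀ : ℚ) (Q : Polynomial ℚ) : Polynomial ℚ :=
  ev (sh x₀ Q) ^ 2 - Polynomial.X * od (sh x₀ Q) ^ 2

/-- Numerator of the EVEN part of `P/Q` about `x₀`. -/
def numE (x₀ : ℚ) (P Q : Polynomial ℚ) : Polynomial ℚ :=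
  ev (sh x₀ P) * ev (sh x₀ Q) - Polynomial.X * (od (sh x₀ P) * od (sh x₀ Q))

/-- Numerator of the ODD part of `P/Q` about `x₀`. -/
def numO (x₀ : ℚ) (P Q : Polynomial ℚ) : Polynomial ℚ :=
  od (sh x₀ P) * ev (sh x₀ Q) - ev (sh x₀ P) * od (sh x₀ Q)

/-- **Euler's parity identity** (pure algebra): if `Q(x₀ + u) ≠ 0 ≠ Q(x₀ − u)` then
`den₂(u²) = Q(x₀+u)Q(x₀−u) ≠ 0` and
`P(x₀ + u)/Q(x₀ + u) = (numE(u²) + u·numO(u²))/den₂(u²)` — i.e. `R(x) = E(u²) + u·O(u²)` with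
`E, O ∈ ℚ(s)` EXPLICIT. [folklore: `R(x₀+u) = R·Q̄/(Q·Q̄)`, `Q̄(u) = Q(x₀−u)`] -/
theorem identity (x₀ : ℚ) (P Q : Polynomial ℚ) (u : ℝ)
    (hQp0 : Polynomial.aeval ((x₀ : ℝ) + u) Q ≠ 0)
    (hQm0 : Polynomial.aeval ((x₀ : ℝ) - u) Q ≠ 0) :
    Polynomial.aeval (u ^ 2) (den₂ x₀ Q) ≠ 0 ∧
      Polynomial.aeval ((x₀ : ℝ) + u) P / Polynomial.aeval ((x₀ : ℝ) + u) Q =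
        (Polynomial.aeval (u ^ 2) (numE x₀ P Q) + u * Polynomial.aeval (u ^ 2) (numO x₀ P Q)) /
          Polynomial.aeval (u ^ 2) (den₂ x₀ Q) := by
  have hQp : Polynomial.aeval ((x₀ : ℝ) + u) Q = Polynomial.aeval (u ^ 2) (ev (sh x₀ Q)) +
      u * Polynomial.aeval (u ^ 2) (od (sh x₀ Q)) := by
    rw [← aeval_sh x₀ Q u, aeval_eq (sh x₀ Q) u]
  have hQm : Polynomial.aeval ((x₀ : ℝ) - u) Q = Polynomial.aeval (u ^ 2) (ev (sh x₀ Q)) -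
      u * Polynomial.aeval (u ^ 2) (od (sh x₀ Q)) := by
    rw [sub_eq_add_neg, ← aeval_sh x₀ Q (-u), aeval_eq (sh x₀ Q) (-u), neg_sq]; ring
  have hPp : Polynomial.aeval ((x₀ : ℝ) + u) P = Polynomial.aeval (u ^ 2) (ev (sh x₀ P)) +
      u * Polynomial.aeval (u ^ 2) (od (sh x₀ P)) := by
    rw [← aeval_sh x₀ P u, aeval_eq (sh x₀ P) u]
  have hQ2 : Polynomial.aeval (u ^ 2) (den₂ x₀ Q) = Polynomial.aeval (u ^ 2) (ev (sh x₀ Q)) ^ 2 -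
      u ^ 2 * Polynomial.aeval (u ^ 2) (od (sh x₀ Q)) ^ 2 := by
    simp only [den₂, map_sub, map_mul, map_pow, Polynomial.aeval_X]
  have hNe : Polynomial.aeval (u ^ 2) (numE x₀ P Q) =
      Polynomial.aeval (u ^ 2) (ev (sh x₀ P)) * Polynomial.aeval (u ^ 2) (ev (sh x₀ Q)) -
        u ^ 2 * (Polynomial.aeval (u ^ 2) (od (sh x₀ P)) *
          Polynomial.aeval (u ^ 2) (od (sh x₀ Q))) := by
    simp only [numE, map_sub, map_mul, Polynomial.aeval_X]
  have hNo : Polynomial.aeval (u ^ 2) (numO x₀ P Q) =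
      Polynomial.aeval (u ^ 2) (od (sh x₀ P)) * Polynomial.aeval (u ^ 2) (ev (sh x₀ Q)) -
        Polynomial.aeval (u ^ 2) (ev (sh x₀ P)) * Polynomial.aeval (u ^ 2) (od (sh x₀ Q)) := by
    simp only [numO, map_sub, map_mul]
  have hQ2ne : Polynomial.aeval (u ^ 2) (den₂ x₀ Q) ≠ 0 := by
    rw [hQ2, show Polynomial.aeval (u ^ 2) (ev (sh x₀ Q)) ^ 2 -
        u ^ 2 * Polynomial.aeval (u ^ 2) (od (sh x₀ Q)) ^ 2 =
        (Polynomial.aeval (u ^ 2) (ev (sh x₀ Q)) + u * Polynomial.aeval (u ^ 2) (od (sh x₀ Q))) *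
          (Polynomial.aeval (u ^ 2) (ev (sh x₀ Q)) - u * Polynomial.aeval (u ^ 2) (od (sh x₀ Q)))
        by ring, ← hQp, ← hQm]
    exact mul_ne_zero hQp0 hQm0
  refine ⟨hQ2ne, ?_⟩
  rw [div_eq_div_iff hQp0 hQ2ne, hPp, hQp, hQ2, hNe, hNo]
  ring

end Parity

end Summit.KontsevichZagierPeriods.RootDecompWalshStrata.ConicDescent
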